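import Summits.HodgeConjecture.CorCM.Census.CentralSquaresDihedralLawUniform
import Summits.HodgeConjecture.CorCM.Census.CyclicCharacterCommutatorLaw
import Summits.HodgeConjecture.CorCM.Census.QuaternionDoublingDihedralEquiv

/-!
# The square-central class, XLVII: THE SMALL-INDEX LAW — a `c`-avoiding subgroup of index `≤ 4` forces `μ(G, c) = φ₂(G, c)`

COR-CM (cell `pub-hodgecm2`), count-neutral kernel combinatorics by the binder seat b09 (gen 49; lane SQUARE-CENTRAL CLASS, part XLVII), on part XLVI
(`isLeast_card_gfaces_generate_of_surjective_dihedral`, THE DIHEDRAL LAW), seat b09 gen 44ʼs commutator law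
(`CyclicCharacter.isLeast_card_gfaces_generate_fibreTwo_of_notMem_commutator`) and seat b23 gen 54ʼs dihedral-equivalence brick
(`QuaternionDoubling.dihedralEquiv`, `QuaternionDoubling.dihedralMap_surjective`) BY NAME.  Theorems only: no definition, no certificate, no named fact,
no `sorry`; `decide` only on `DihedralGroup 4`.  HONEST FRAMING: `HC_CM` is NOT proved, here or anywhere in the tree; nothing here is a period or a
headline — these are census laws `μ(G, c)` for the face-relation lattice.

THE FRONTIER LEMMA.  The two structural laws of the square-central lane close a row `(G, c)` (a finite `2`-group `G`, a central involution `c`) as soon as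
EITHER `c ∉ [G, G]` (commutator law) OR `G ↠ D₄` with `c ↦ r²` (dihedral law).  This file packages both into ONE index criterion and shows it is
exhaustive for small indices:

* §1 (group theory) a subgroup `S ∌ c` of index `2` forces `c ∉ [G, G]` (`notMem_commutator_of_index_two_of_notMem`); a subgroup `S ∌ c` of index `4`
  forces `c ∉ [G, G]` OR a surjection `π : G ↠ D₄` with `π c = r²` (`exists_dihedral_or_notMem_commutator_of_index_four`).  Proof: `N = core_G(S)`;
  `G/N ↪ Sym(G/S)` gives `[G:N] ∣ 24`, and `[G:N]` is a power of `2`, so `[G:N] ∈ {4, 8}`; `[G:N] = 4` ⟹ `S = N ⊴ G` with `G/S` of order `4`, hence abelian,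
  hence `[G,G] ≤ S ∌ c`; `[G:N] = 8` ⟹ `S/N` is a NON-NORMAL subgroup of order `2` of `G/N`, so `G/N` is non-abelian, not cyclic, not of exponent `2`: it has
  an element `ū` of order `4`, and the generator `w̄` of `S/N` lies outside `⟨ū⟩` and inverts it — a dihedral presentation, `G/N ≅ D₄` by seat b23ʼs
  `dihedralEquiv`, under which the non-trivial central element `c̄` goes to `r²`.
* §2 **THE SMALL-INDEX LAW** (`isLeast_card_gfaces_generate_of_index_le_four`): `G` a finite `2`-group, `c` a central involution, `S ∌ c` a subgroup of index
  `≤ 4` ⟹ **`μ(G, c) = φ₂(G, c)`**; in particular when `S` is the stabiliser of a CM type (a block of at most four types;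
  `isLeast_card_gfaces_generate_of_stabiliser_index_le_four`).  The index-`2` case holds for EVERY finite group (`…_of_index_two`).
* §3 **THE FRONTIER** (`eight_le_index_of_notMem`): if `c ∈ [G, G]` and no surjection `G ↠ D₄` carries `c` to `r²` — the rows of the census left open by
  the two laws — then EVERY subgroup avoiding `c` has index `≥ 8`; every block of CM types of such a row has at least eight types (the numerics of this
  generation: all 34 open rows `(G, c)` of order `32` have blocks of sizes `8, 16, 32` only).

## References
* [Pohlmann1968] H. Pohlmann, Algebraic cycles on abelian varieties of complex multiplication type, Ann. of Math. 88 (1968), Thm 1.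
-/

namespace Summit.HodgeConjecture.CorCM.Census.CentralSquares

open Finset DihedralGroup
open Summit.HodgeConjecture.CorCM.Prior.AllgGroup.RfwfAllgGroup
open Summit.HodgeConjecture.CorCM.Census.BlockParity
open Summit.HodgeConjecture.CorCM.Census.Coinvariant

noncomputable section

/-! ## §1 Group theory: `c`-avoiding subgroups of index `2` and `4` -/

section GroupTheory

variable {K : Type*} [Group K]

/-- A group in which every element squares to `1` is commutative. [folklore] -/
theorem smallIndex_comm_of_mul_self_eq_one (h : ∀ x : K, x * x = 1) (a b : K) : a * b = b * a := by
  have hinv : ∀ x : K, x⁻¹ = x := fun x => inv_eq_of_mul_eq_one_right (h x)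
  calc a * b = (a * b)⁻¹ := (hinv _).symm
    _ = b⁻¹ * a⁻¹ := mul_inv_rev a b
    _ = b * a := by rw [hinv, hinv]

/-- If `G/N` is commutative then `[G, G] ≤ N`. [folklore] -/
theorem smallIndex_commutator_le_of_quotient_comm (N : Subgroup K) [N.Normal] (hcomm : ∀ a b : K ⧸ N, a * b = b * a) :
    commutator K ≤ N := by
  rw [commutator_def, Subgroup.commutator_le]
  intro a _ b _
  rw [← QuotientGroup.eq_one_iff, commutatorElement_def, QuotientGroup.mk_mul, QuotientGroup.mk_mul, QuotientGroup.mk_mul,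
    QuotientGroup.mk_inv, QuotientGroup.mk_inv, hcomm (a : K ⧸ N) (b : K ⧸ N), mul_inv_cancel_right, mul_inv_cancel]

/-- The elements of `⟨u⟩` for `u` of order `4` are `1, u, u², u⁻¹`. [folklore] -/
theorem smallIndex_mem_zpowers_of_orderOf_four {u y : K} (hu : orderOf u = 4) (hy : y ∈ Subgroup.zpowers u) :
    y = 1 ∨ y = u ∨ y = u ^ 2 ∨ y = u⁻¹ := by
  obtain ⟨k, rfl⟩ := Subgroup.mem_zpowers_iff.mp hy
  rw [← zpow_mod_orderOf, hu]
  have h4 : u ^ (4 : ℤ) = 1 := by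
    rw [show (4 : ℤ) = ((4 : ℕ) : ℤ) from rfl, zpow_natCast, ← hu, pow_orderOf_eq_one]
  have hlt : k % (4 : ℕ) < 4 := Int.emod_lt_of_pos k (by norm_num)
  have hge : 0 ≤ k % (4 : ℕ) := Int.emod_nonneg k (by norm_num)
  have hcases : k % (4 : ℕ) = 0 ∨ k % (4 : ℕ) = 1 ∨ k % (4 : ℕ) = 2 ∨ k % (4 : ℕ) = 3 := by omega
  rcases hcases with h | h | h | h <;> rw [h]
  · exact Or.inl (zpow_zero u)
  · exact Or.inr (Or.inl (zpow_one u))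
  · exact Or.inr (Or.inr (Or.inl (by rw [show (2 : ℤ) = ((2 : ℕ) : ℤ) from rfl, zpow_natCast])))
  · refine Or.inr (Or.inr (Or.inr ?_))
    rw [show (3 : ℤ) = 4 + (-1) by norm_num, zpow_add, h4, one_mul, zpow_neg_one]

/-- For `u` of order `4`: `u² ≠ 1`, so `u` and `u⁻¹` do not square to `1` and `u²` has order `≠ 4`. [folklore] -/
theorem smallIndex_sq_ne_one_of_orderOf_four {u : K} (hu : orderOf u = 4) : u * u ≠ 1 := by
  intro h
  have h2 : orderOf u ∣ 2 := orderOf_dvd_of_pow_eq_one (by rw [pow_two, h])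
  rw [hu] at h2
  exact absurd (Nat.le_of_dvd (by norm_num) h2) (by norm_num)

/-- An element of `⟨u⟩` of order `4` (for `u` of order `4`) is `u` or `u⁻¹`. [folklore] -/
theorem smallIndex_eq_or_eq_inv_of_orderOf_four {u y : K} (hu : orderOf u = 4) (hy : y ∈ Subgroup.zpowers u) (hy4 : orderOf y = 4) :
    y = u ∨ y = u⁻¹ := by
  rcases smallIndex_mem_zpowers_of_orderOf_four hu hy with h | h | h | h
  · rw [h, orderOf_one] at hy4; exact absurd hy4 (by norm_num)
  · exact Or.inl h
  · exfalso
    have h4 : u ^ 4 = 1 := by rw [← hu]; exact pow_orderOf_eq_one u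
    have h1 : (u ^ 2) * (u ^ 2) = 1 := by rw [← pow_add]; exact h4
    exact smallIndex_sq_ne_one_of_orderOf_four (h ▸ hy4) h1
  · exact Or.inr h

/-- In a group in which `⟨u⟩` (`u` of order `4`) is normal, every conjugate of `u` is `u` or `u⁻¹`, hence `u²` is central. [folklore] -/
theorem smallIndex_conj_eq_or {u : K} (hu : orderOf u = 4) (hn : (Subgroup.zpowers u).Normal) (g : K) :
    g * u * g⁻¹ = u ∨ g * u * g⁻¹ = u⁻¹ := by
  have hmem : g * u * g⁻¹ ∈ Subgroup.zpowers u := hn.conj_mem u (Subgroup.mem_zpowers u) g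
  have hord : orderOf (g * u * g⁻¹) = 4 := by
    have h := orderOf_injective (MulAut.conj g).toMonoidHom (MulAut.conj g).injective u
    rw [MulEquiv.coe_toMonoidHom, MulAut.conj_apply, hu] at h
    exact h
  exact smallIndex_eq_or_eq_inv_of_orderOf_four hu hmem hord

/-- `u²` is central when every conjugate of `u` (of order `4`) is `u^{±1}`. [folklore] -/
theorem smallIndex_sq_central {u : K} (hu : orderOf u = 4) (hn : (Subgroup.zpowers u).Normal) (g : K) :
    g * (u * u) = (u * u) * g := by
  have h4 : u ^ 4 = 1 := by rw [← hu, pow_orderOf_eq_one]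
  have key : g * (u * u) * g⁻¹ = u * u := by
    have e : g * (u * u) * g⁻¹ = (g * u * g⁻¹) * (g * u * g⁻¹) := by group
    rw [e]
    rcases smallIndex_conj_eq_or hu hn g with h | h <;> rw [h]
    -- `u⁻¹ u⁻¹ = u u` since `u⁴ = 1`
    have h2 : (u * u) * (u * u) = 1 := by rw [← pow_two u, ← pow_add]; exact h4
    rw [← mul_inv_rev, inv_eq_of_mul_eq_one_right h2]
  calc g * (u * u) = g * (u * u) * g⁻¹ * g := by rw [inv_mul_cancel_right]
    _ = u * u * g := by rw [key]

/-- In `DihedralGroup 4` the only non-trivial central element is `r 2`. [folklore] -/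
theorem smallIndex_dihedral_central_eq_r_two : ∀ d : DihedralGroup 4, d ≠ 1 → (∀ y : DihedralGroup 4, y * d = d * y) → d = r 2 := by decide

/-- **INDEX TWO.**  A subgroup `S ∌ c` of index `2` forces `c ∉ [G, G]` (`G/S` has order `2`, hence is abelian). [folklore] -/
theorem notMem_commutator_of_index_two_of_notMem {c : K} {S : Subgroup K} (hS : S.index = 2) (hcS : c ∉ S) : c ∉ commutator K := by
  haveI : S.Normal := Subgroup.normal_of_index_eq_two hS
  have hcard : Nat.card (K ⧸ S) = 2 := by rw [← Subgroup.index_eq_card, hS]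
  have hsq : ∀ x : K ⧸ S, x * x = 1 := fun x => by
    rw [← pow_two, ← orderOf_dvd_iff_pow_eq_one, ← hcard]
    exact orderOf_dvd_natCard x
  exact fun hc => hcS (smallIndex_commutator_le_of_quotient_comm S (smallIndex_comm_of_mul_self_eq_one hsq) hc)

variable [Fintype K]

/-- **INDEX FOUR — THE DICHOTOMY.**  `G` a finite `2`-group, `c` central, `S ∌ c` of index `4` ⟹ `c ∉ [G, G]`, or there is a surjection
`π : G ↠ D₄` with `π c = r 2`. [folklore] -/
theorem exists_dihedral_or_notMem_commutator_of_index_four (hG : IsPGroup 2 K) {c : K} (hcen : ∀ x : K, x * c = c * x)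
    {S : Subgroup K} (hS : S.index = 4) (hcS : c ∉ S) :
    c ∉ commutator K ∨ ∃ π : K →* DihedralGroup 4, Function.Surjective π ∧ π c = r 2 := by
  classical
  set N := S.normalCore with hN
  haveI hNn : N.Normal := S.normalCore_normal
  have hNS : N ≤ S := S.normalCore_le
  have hcN : c ∉ N := fun h => hcS (hNS h)
  -- `[G : N] ∣ 4! = 24`, `[G : N] = [S : N] · 4` and `[G : N]` is a power of `2`
  have hdvd : N.index ∣ Nat.factorial S.index := by
    rw [hN, Subgroup.normalCore_eq_ker, Subgroup.index_ker, Subgroup.index_eq_card, ← Nat.card_perm]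
    exact Subgroup.card_subgroup_dvd_card (MulAction.toPermHom K (K ⧸ S)).range
  rw [hS, show Nat.factorial 4 = 8 * 3 by decide] at hdvd
  have hmul : N.relIndex S * 4 = N.index := by rw [← hS]; exact Subgroup.relIndex_mul_index hNS
  obtain ⟨j, hj⟩ := hG.index N
  have hj8 : 2 ^ j ∣ 8 := by
    rw [hj] at hdvd
    exact (Nat.Coprime.pow_left j (by norm_num : Nat.Coprime 2 3)).dvd_of_dvd_mul_right hdvd
  have hr : N.relIndex S = 1 ∨ N.relIndex S = 2 := by
    have hle : N.relIndex S * 4 ≤ 8 := by rw [hmul, hj]; exact Nat.le_of_dvd (by norm_num) hj8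
    have hpos : 0 < N.relIndex S * 4 := by rw [hmul, hj]; exact pow_pos (by norm_num) j
    omega
  rcases hr with h1 | h2
  · -- `S = N` is normal with abelian quotient of order `4`
    left
    have heq : N = S := le_antisymm hNS (Subgroup.relIndex_eq_one.1 h1)
    haveI hSn : S.Normal := by rw [← heq]; exact hNn
    have hcard : Nat.card (K ⧸ S) = 2 ^ 2 := by rw [← Subgroup.index_eq_card, hS]; norm_num
    have hcomm : ∀ a b : K ⧸ S, a * b = b * a := fun a b =>
      (IsPGroup.isMulCommutative_of_card_eq_prime_sq hcard).is_comm.comm a b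
    exact fun hc => hcS (smallIndex_commutator_le_of_quotient_comm S hcomm hc)
  · right
    have hcardQ : Nat.card (K ⧸ N) = 8 := by rw [← Subgroup.index_eq_card, ← hmul, h2]
    -- an element `w ∈ S ∖ N`; its class `w̄` is an involution
    have hSN : ¬ S ≤ N := fun hle => by
      rw [Subgroup.relIndex_eq_one.2 hle] at h2; exact absurd h2 (by norm_num)
    obtain ⟨w, hwS, hwN⟩ := Set.not_subset.1 hSN
    let mk : K →* K ⧸ N := QuotientGroup.mk' N
    have hmk : ∀ g : K, mk g = (g : K ⧸ N) := fun g => rfl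
    have hw1 : mk w ≠ 1 := by rw [hmk, Ne, QuotientGroup.eq_one_iff]; exact hwN
    have hww : mk w * mk w = 1 := by
      have h2' : (N.subgroupOf S).index = 2 := h2
      have hm := Subgroup.mul_self_mem_of_index_two h2' ⟨w, hwS⟩
      rw [Subgroup.mem_subgroupOf] at hm
      rw [← map_mul, hmk, QuotientGroup.eq_one_iff]; exact hm
    -- `w̄` is NOT central: otherwise `⟨N, w⟩` would be a normal subgroup of `G` inside `S` larger than the core
    have hwc : ¬ ∀ g : K ⧸ N, g * mk w = mk w * g := by
      intro hall
      let N' : Subgroup K := (Subgroup.zpowers (mk w)).comap mk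
      haveI hzn : (Subgroup.zpowers (mk w)).Normal := by
        refine ⟨fun x hx g => ?_⟩
        obtain ⟨k, rfl⟩ := Subgroup.mem_zpowers_iff.mp hx
        have hcg : Commute g (mk w) := hall g
        have hc' : g * mk w ^ k = mk w ^ k * g := (hcg.zpow_right k).eq
        rw [hc', mul_inv_cancel_right]
        exact Subgroup.zpow_mem_zpowers _ _
      haveI : N'.Normal := Subgroup.normal_comap _
      have hN'S : N' ≤ S := by
        intro x hx
        obtain ⟨k, hk⟩ := Subgroup.mem_zpowers_iff.mp (Subgroup.mem_comap.mp hx)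
        rw [← map_zpow, hmk, hmk, QuotientGroup.eq] at hk
        have e : x = w ^ k * ((w ^ k)⁻¹ * x) := by rw [mul_inv_cancel_left]
        rw [e]; exact S.mul_mem (S.zpow_mem hwS k) (hNS hk)
      have hle : N' ≤ N := by rw [hN]; exact Subgroup.normal_le_normalCore.mpr hN'S
      exact hwN (hle (Subgroup.mem_comap.mpr (Subgroup.mem_zpowers (mk w))))
    -- an element of order `4` in `G/N` (else `G/N` is cyclic or of exponent `2`, hence abelian)
    have hex : ∃ u : K ⧸ N, orderOf u = 4 := by
      by_contra hno
      push Not at hno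
      have h8 : (Nat.divisors 8) = {1, 2, 4, 8} := by decide
      have hords : ∀ x : K ⧸ N, orderOf x = 1 ∨ orderOf x = 2 ∨ orderOf x = 8 := by
        intro x
        have hd : orderOf x ∈ Nat.divisors 8 := Nat.mem_divisors.2 ⟨hcardQ ▸ orderOf_dvd_natCard x, by norm_num⟩
        rw [h8] at hd
        simp only [Finset.mem_insert, Finset.mem_singleton] at hd
        rcases hd with h | h | h | h
        · exact Or.inl h
        · exact Or.inr (Or.inl h)
        · exact absurd h (hno x)
        · exact Or.inr (Or.inr h)
      by_cases hcyc : ∃ x : K ⧸ N, orderOf x = 8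
      · obtain ⟨x, hx⟩ := hcyc
        have htop : Subgroup.zpowers x = ⊤ := by
          apply Subgroup.eq_top_of_card_eq
          rw [Nat.card_zpowers, hx, hcardQ]
        apply hwc
        intro g
        obtain ⟨a, rfl⟩ := Subgroup.mem_zpowers_iff.mp (htop ▸ Subgroup.mem_top g : g ∈ Subgroup.zpowers x)
        obtain ⟨b, hb⟩ := Subgroup.mem_zpowers_iff.mp (htop ▸ Subgroup.mem_top (mk w) : mk w ∈ Subgroup.zpowers x)
        rw [← hb]; exact zpow_mul_comm x a b
      · push Not at hcyc
        have hsq : ∀ x : K ⧸ N, x * x = 1 := by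
          intro x
          rcases hords x with h | h | h
          · rw [orderOf_eq_one_iff.mp h, mul_one]
          · rw [← pow_two, ← h, pow_orderOf_eq_one]
          · exact absurd h (hcyc x)
        exact hwc fun g => smallIndex_comm_of_mul_self_eq_one hsq g (mk w)
    obtain ⟨u, hu⟩ := hex
    have hindex : (Subgroup.zpowers u).index = 2 := by
      have h := (Subgroup.zpowers u).card_mul_index
      rw [Nat.card_zpowers, hu, hcardQ] at h
      omega
    haveI hun : (Subgroup.zpowers u).Normal := Subgroup.normal_of_index_eq_two hindex
    -- `w̄ ∉ ⟨ū⟩`: the only involution there is the central `ū²`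
    have hw : mk w ∉ Subgroup.zpowers u := by
      intro hmem
      rcases smallIndex_mem_zpowers_of_orderOf_four hu hmem with h | h | h | h
      · exact hw1 h
      · exact smallIndex_sq_ne_one_of_orderOf_four hu (by rw [← h]; exact hww)
      · apply hwc; intro g; rw [h, pow_two]; exact smallIndex_sq_central hu hun g
      · apply smallIndex_sq_ne_one_of_orderOf_four hu
        rw [h, ← mul_inv_rev, inv_eq_one] at hww
        exact hww
    -- `w̄` inverts `ū`: it conjugates `ū` to `ū` or `ū⁻¹`, and the first would make `w̄` central
    have hwu : mk w * u * (mk w)⁻¹ = u⁻¹ := by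
      rcases smallIndex_conj_eq_or hu hun (mk w) with h | h
      · exfalso
        have hcomm : Commute (mk w) u := by
          calc mk w * u = mk w * u * (mk w)⁻¹ * mk w := by rw [inv_mul_cancel_right]
            _ = u * mk w := by rw [h]
        apply hwc
        intro g
        obtain ⟨d, rfl⟩ := QuaternionDoubling.dihedralMap_surjective (n := 4) hu hindex hw g
        cases d with
        | r i => exact ((hcomm.pow_right i.val).symm : Commute (u ^ i.val) (mk w))
        | sr i =>
          change mk w * u ^ i.val * mk w = mk w * (mk w * u ^ i.val)
          rw [mul_assoc, (hcomm.pow_right i.val).eq]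
      · exact h
    -- the dihedral presentation of `G/N` and the surjection
    letI : Fintype (K ⧸ N) := Fintype.ofFinite _
    let e : DihedralGroup 4 ≃* K ⧸ N := QuaternionDoubling.dihedralEquiv hu hindex hw hww hwu
    let π : K →* DihedralGroup 4 := e.symm.toMonoidHom.comp mk
    refine ⟨π, e.symm.surjective.comp (QuotientGroup.mk'_surjective N), ?_⟩
    have hπc : π c = e.symm (mk c) := rfl
    rw [hπc]
    apply smallIndex_dihedral_central_eq_r_two
    · rw [MulEquiv.map_ne_one_iff, hmk, Ne, QuotientGroup.eq_one_iff]; exact hcN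
    · intro y
      obtain ⟨z, rfl⟩ := e.symm.surjective y
      obtain ⟨g, rfl⟩ := QuotientGroup.mk'_surjective N z
      change e.symm (mk g) * e.symm (mk c) = e.symm (mk c) * e.symm (mk g)
      rw [← map_mul, ← map_mul, ← map_mul, ← map_mul, hcen g]

end GroupTheory

/-! ## §2 The small-index law -/

variable {G : Type*} [Group G] [Fintype G] [DecidableEq G]

/-- **INDEX TWO (every finite group).**  A subgroup `S ∌ c` of index `2` ⟹ `μ(G, c) = φ₂(G, c)` — by the commutator law. [folklore] -/
theorem isLeast_card_gfaces_generate_of_index_two {c : G} (hc2 : c * c = 1) (hcen : ∀ x : G, x * c = c * x)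
    (S : Subgroup G) (hS : S.index = 2) (hcS : c ∉ S) :
    IsLeast {n : ℕ | ∃ T : Finset (CMF G c →₀ ℤ), (↑T ⊆ gfaceSet G c hc2) ∧ T.card = n ∧
      hodgeSpan c hc2 ≤ Submodule.span ℤ (pairSet c) ⊔ Submodule.span ℤ (translates c T)} (fibreTwo c hc2) :=
  CyclicCharacter.isLeast_card_gfaces_generate_fibreTwo_of_notMem_commutator hc2 hcen (notMem_commutator_of_index_two_of_notMem hS hcS)

/-- **THE SMALL-INDEX LAW.**  `G` a finite `2`-group, `c` a central involution, `S ∌ c` a subgroup of index `≤ 4` ⟹ **`μ(G, c) = φ₂(G, c)`**: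
index `1` is impossible, index `2` is the commutator law, index `4` is the commutator law or THE DIHEDRAL LAW through the dichotomy of §1.
[folklore] -/
theorem isLeast_card_gfaces_generate_of_index_le_four (hG : IsPGroup 2 G) {c : G} (hc2 : c * c = 1) (hcen : ∀ x : G, x * c = c * x)
    (S : Subgroup G) (hcS : c ∉ S) (hS4 : S.index ≤ 4) :
    IsLeast {n : ℕ | ∃ T : Finset (CMF G c →₀ ℤ), (↑T ⊆ gfaceSet G c hc2) ∧ T.card = n ∧
      hodgeSpan c hc2 ≤ Submodule.span ℤ (pairSet c) ⊔ Submodule.span ℤ (translates c T)} (fibreTwo c hc2) := by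
  obtain ⟨j, hj⟩ := hG.index S
  have hj2 : j ≤ 2 := by
    by_contra h
    have h8 : 2 ^ 3 ≤ 2 ^ j := Nat.pow_le_pow_right (by norm_num) (by omega)
    rw [← hj] at h8
    omega
  interval_cases j
  · exfalso
    rw [pow_zero, Subgroup.index_eq_one] at hj
    exact hcS (hj ▸ Subgroup.mem_top c)
  · exact isLeast_card_gfaces_generate_of_index_two hc2 hcen S hj hcS
  · rcases exists_dihedral_or_notMem_commutator_of_index_four hG hcen hj hcS with hK | ⟨π, hπ, hπc⟩
    · exact CyclicCharacter.isLeast_card_gfaces_generate_fibreTwo_of_notMem_commutator hc2 hcen hK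
    · exact isLeast_card_gfaces_generate_of_surjective_dihedral hG hc2 hcen π hπ hπc

/-- A CM type is never fixed by the base change along `c` (that is its complement). [folklore] -/
theorem smallIndex_rt_self_ne {c : G} (hcen : ∀ x : G, x * c = c * x) (Φ : CMF G c) : rt c c Φ ≠ Φ := by
  intro h
  have h1 : (univ \ Φ.1) = Φ.1 := by rw [← rt_self_val c hcen Φ, h]
  have h2 : (1 : G) ∈ univ \ Φ.1 ↔ (1 : G) ∈ Φ.1 := by rw [h1]
  rw [mem_sdiff] at h2
  simp only [mem_univ, true_and] at h2
  exact iff_not_self (h2.symm)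

/-- **THE SMALL-INDEX LAW, BLOCK FORM.**  If the stabiliser `S = {Q | Φ·Q⁻¹ = Φ}` of some CM type `Φ` has index `≤ 4` (the block of `Φ` has at most
four types) then `μ(G, c) = φ₂(G, c)`. [folklore] -/
theorem isLeast_card_gfaces_generate_of_stabiliser_index_le_four (hG : IsPGroup 2 G) {c : G} (hc2 : c * c = 1)
    (hcen : ∀ x : G, x * c = c * x) (Φ : CMF G c) (S : Subgroup G) (hS : ∀ Q : G, Q ∈ S ↔ rt c Q Φ = Φ) (hS4 : S.index ≤ 4) :
    IsLeast {n : ℕ | ∃ T : Finset (CMF G c →₀ ℤ), (↑T ⊆ gfaceSet G c hc2) ∧ T.card = n ∧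
      hodgeSpan c hc2 ≤ Submodule.span ℤ (pairSet c) ⊔ Submodule.span ℤ (translates c T)} (fibreTwo c hc2) :=
  isLeast_card_gfaces_generate_of_index_le_four hG hc2 hcen S (fun hc => smallIndex_rt_self_ne hcen Φ ((hS c).1 hc)) hS4

/-! ## §3 The frontier: in an open row every `c`-avoiding subgroup has index `≥ 8` -/

omit [DecidableEq G] in
/-- **THE FRONTIER.**  `G` a finite `2`-group, `c` central with `c ∈ [G, G]` and NO surjection `G ↠ D₄` carrying `c` to `r²`: every subgroup `S ∌ c`
has index at least `8` — the rows left open by the commutator law and the dihedral law have blocks of at least eight CM types. [folklore] -/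
theorem eight_le_index_of_notMem (hG : IsPGroup 2 G) {c : G} (hcen : ∀ x : G, x * c = c * x) (hcomm : c ∈ commutator G)
    (hno : ∀ π : G →* DihedralGroup 4, Function.Surjective π → π c ≠ r 2) (S : Subgroup G) (hcS : c ∉ S) : 8 ≤ S.index := by
  obtain ⟨j, hj⟩ := hG.index S
  by_cases hj3 : 3 ≤ j
  · rw [hj]
    calc 8 = 2 ^ 3 := by norm_num
      _ ≤ 2 ^ j := Nat.pow_le_pow_right (by norm_num) hj3
  · exfalso
    have hj2 : j ≤ 2 := by omega
    interval_cases j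
    · rw [pow_zero, Subgroup.index_eq_one] at hj
      exact hcS (hj ▸ Subgroup.mem_top c)
    · exact notMem_commutator_of_index_two_of_notMem hj hcS hcomm
    · rcases exists_dihedral_or_notMem_commutator_of_index_four hG hcen hj hcS with hK | ⟨π, hπ, hπc⟩
      · exact hK hcomm
      · exact hno π hπ hπc

end

end Summit.HodgeConjecture.CorCM.Census.CentralSquares
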